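import Mathlib
import Literature.NumberTheory.Transcendental.BakerLogarithms
import HarnessLib

/-!
# Baker's theorem — the auxiliary function in closed form (Lemmas 2–5 of Baker 1975, Ch. 2)

Trunk T-TRANSCEND, family `periods`, fact `Literature.NumberTheory.Transcendental.baker` (**periods.S13**); sequel to
`BakerLogarithms.lean`, which reduced Theorem 2.1 of A. Baker, *Transcendental Number Theory*
(1975), Ch. 2, to the impossibility of the normal form (1) (`Baker1975.NormalForm`).

This file sets up the auxiliary function of Baker's proof (Lemma 2, p. 21) *in closed form*, so
that no several-variable calculus is needed. For data `S : Setup` of a normalised counterexample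
(logarithms `l₀, …, lₙ` — Baker's `log α₁, …, log αₙ` with his `n` our `n + 1` — and algebraic
`β₀, β₀', …` with `β₀ + ∑ βᵣ lᵣ = lₙ`), integer coefficients `p(λ)` indexed by
`λ = (λ₀, λ') ∈ Idx n L = [0,L] × [0,L]^{n+1}` and a multi-index `m ∈ ℕ^{n+1}`, the function
`F p m : ℂ → ℂ` is Baker's `f(z) = Φ_{m₀,…,m_{n-1}}(z, …, z)` (eq. (7), p. 22) written out via the
closed form (5), p. 21, of the partial derivatives of
`Φ(z₀,…,z_{n-1}) = ∑ p(λ) z₀^{λ₀} e^{λₙβ₀z₀} α₁^{γ₁z₁} ⋯ α_{n-1}^{γ_{n-1}z_{n-1}}`: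
each term is `Q(m₀, λ₀, λₙβ₀, z) · ∏ᵣ (γᵣ log αᵣ)^{mᵣ} · e^{ψ_λ z}` with
`Q m a b z = e^{-bz} (d/dz)^m (z^a e^{bz})` (Baker's `q(λ₀, λₙ, z)`), `γᵣ = λᵣ + λₙ βᵣ` and
`ψ_λ = ∑ λᵢ log αᵢ` (the relation (1) is used to identify `e^{λₙβ₀z} ∏ αᵣ^{γᵣ z}` with `e^{ψ_λ z}`
on the diagonal).

Main results:
* `Setup.hasDerivAt_F`, `Setup.deriv_F`: `(d/dz) F_m = ∑ᵢ F_{m+eᵢ}` — the chain rule of p. 23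
  ("`f_m(r)` is `(∂/∂z₀ + ⋯ + ∂/∂z_{n-1})^m Φ` on the diagonal");
* `Setup.iteratedDeriv_F_eq_zero`: vanishing of all `F_{m'}(r)`, `|m'| ≤ T`, gives vanishing of
  `F_m^{(j)}(r)` for `|m| + j ≤ T` (Lemma 4, p. 23);
* `Setup.iteratedDeriv_F_zero`: `φ_j(0) = ∑_λ p(λ) j(j-1)⋯(j-λ₀+1) ψ_λ^{j-λ₀}` (§5, p. 26);
* `Setup.norm_F_le`: the growth bound of Lemma 3 (p. 22),
  `|F_m(z)| ≤ (L+1)^{n+2} B (2LB_βΛ)^{|m|} max(1,|z|)^L e^{LΛ|z|}` when `|p(λ)| ≤ B`.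

The arithmetic half of Lemma 3, the Siegel step (Lemma 2), the extrapolation (Lemmas 4–5) and
§5 follow in sequels.

## References

* [Baker1975] A. Baker, *Transcendental Number Theory*, Cambridge Univ. Press, 1975
  (doi:10.1017/cbo9780511565977), Ch. 2 §§3–5, pp. 19–27.
-/

noncomputable section

open Complex Finset

namespace Literature.NumberTheory.Transcendental.Baker1975

/-! ### The polynomials `Q` and the exponential monomials `z^a e^{bz}` -/

/-- Baker's `q(λ₀, λₙ, z)` (Baker 1975, p. 21), in the normalisation
`Q m a b z = e^{-bz} (d/dz)^m (z^a e^{bz}) = ∑_{μ ≤ m} (m choose μ) a(a-1)⋯(a-μ+1) b^{m-μ} z^{a-μ}`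
(so `q(λ₀, λₙ, z) = Q m₀ λ₀ (λₙ β₀) z`), over any commutative semiring.
[cite: Baker1975, Ch. 2 Lemma 2] -/
def Q {A : Type*} [CommSemiring A] (m a : ℕ) (b z : A) : A :=
  ∑ μ ∈ range (m + 1), (m.choose μ : A) * (a.descFactorial μ : A) * b ^ (m - μ) * z ^ (a - μ)

section Q

variable {A B : Type*} [CommSemiring A] [CommSemiring B]

/-- `Q 0 a b z = z^a`. [folklore] -/
@[simp] theorem Q_zero (a : ℕ) (b z : A) : Q 0 a b z = z ^ a := by
  simp [Q]

/-- `Q` commutes with ring homomorphisms. [folklore] -/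
theorem map_Q (f : A →+* B) (m a : ℕ) (b z : A) :
    f (Q m a b z) = Q m a (f b) (f z) := by
  simp [Q, map_sum]

/-- The value at `0`: `Q m a b 0 = m(m-1)⋯(m-a+1) b^{m-a}` (the number
`[dʲ/dzʲ (z^ν e^{ψ z})]_{z=0} = j(j-1)⋯(j-ν+1) ψ^{j-ν}` of Baker 1975, p. 26).
[cite: Baker1975, Ch. 2 §5] -/
theorem Q_at_zero (m a : ℕ) (b : A) : Q m a b 0 = (m.descFactorial a : A) * b ^ (m - a) := by
  unfold Q
  rw [sum_eq_single a]
  · by_cases ham : a ≤ m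
    · simp [Nat.descFactorial_self, Nat.descFactorial_eq_factorial_mul_choose m a, mul_comm]
    · have h1 : m.descFactorial a = 0 := Nat.descFactorial_eq_zero_iff_lt.mpr (by omega)
      have h2 : m.choose a = 0 := Nat.choose_eq_zero_of_lt (by omega)
      simp [h1, h2]
  · intro μ _ hμ
    rcases lt_or_gt_of_ne hμ with h | h
    · have : a - μ ≠ 0 := by omega
      simp [zero_pow this]
    · have : a.descFactorial μ = 0 := Nat.descFactorial_eq_zero_iff_lt.mpr h
      simp [this]
  · intro ha
    have h : m < a := by simpa using ha
    have h2 : m.choose a = 0 := Nat.choose_eq_zero_of_lt h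
    simp [h2]

end Q

/-- The norm bound `|Q m a b z| ≤ (a + |b|)^m max(1,|z|)^a` (Baker 1975, p. 22:
`|q(λ₀, λₙ, z)| ≤ (2c₇L)^{m₀} (|z|+1)^L`). [cite: Baker1975, Ch. 2 Lemma 3] -/
theorem norm_Q_le (m a : ℕ) (b z : ℂ) :
    ‖Q m a b z‖ ≤ ((a : ℝ) + ‖b‖) ^ m * max 1 ‖z‖ ^ a := by
  unfold Q
  have hz1 : (1 : ℝ) ≤ max 1 ‖z‖ := le_max_left _ _
  calc ‖∑ μ ∈ range (m + 1), (m.choose μ : ℂ) * (a.descFactorial μ : ℂ) * b ^ (m - μ) * z ^ (a - μ)‖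
      ≤ ∑ μ ∈ range (m + 1), ‖(m.choose μ : ℂ) * (a.descFactorial μ : ℂ) * b ^ (m - μ) * z ^ (a - μ)‖ :=
        norm_sum_le _ _
    _ ≤ ∑ μ ∈ range (m + 1), ((a : ℝ) ^ μ * ‖b‖ ^ (m - μ) * (m.choose μ : ℝ)) * max 1 ‖z‖ ^ a := by
        refine sum_le_sum fun μ _ => ?_
        rw [norm_mul, norm_mul, norm_mul, Complex.norm_natCast, Complex.norm_natCast, norm_pow,
          norm_pow]
        have h1 : (a.descFactorial μ : ℝ) ≤ (a : ℝ) ^ μ := by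
          exact_mod_cast Nat.descFactorial_le_pow a μ
        have h2 : ‖z‖ ^ (a - μ) ≤ max 1 ‖z‖ ^ a :=
          (pow_le_pow_left₀ (norm_nonneg _) (le_max_right _ _) _).trans
            (pow_le_pow_right₀ hz1 (Nat.sub_le _ _))
        calc (m.choose μ : ℝ) * (a.descFactorial μ : ℝ) * ‖b‖ ^ (m - μ) * ‖z‖ ^ (a - μ)
            ≤ (m.choose μ : ℝ) * (a : ℝ) ^ μ * ‖b‖ ^ (m - μ) * max 1 ‖z‖ ^ a := by
              gcongr
          _ = ((a : ℝ) ^ μ * ‖b‖ ^ (m - μ) * (m.choose μ : ℝ)) * max 1 ‖z‖ ^ a := by ring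
    _ = ((a : ℝ) + ‖b‖) ^ m * max 1 ‖z‖ ^ a := by
        rw [← sum_mul, ← add_pow]

/-- The exponential monomial `z ↦ z^a e^{bz}`. [folklore] -/
def expMonomial (a : ℕ) (b : ℂ) : ℂ → ℂ := fun z => z ^ a * cexp (b * z)

/-- `z^a e^{bz}` is entire. [folklore] -/
theorem differentiable_expMonomial (a : ℕ) (b : ℂ) : Differentiable ℂ (expMonomial a b) := by
  unfold expMonomial; fun_prop

/-- **Leibniz formula**: `(d/dz)^m (z^a e^{bz}) = Q m a b z · e^{bz}`. [folklore] -/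
theorem iteratedDeriv_expMonomial (m a : ℕ) (b z : ℂ) :
    iteratedDeriv m (expMonomial a b) z = Q m a b z * cexp (b * z) := by
  have hf : ContDiffAt ℂ m (fun w : ℂ => w ^ a) z := by fun_prop
  have hg : ContDiffAt ℂ m (fun w : ℂ => cexp (b * w)) z := by fun_prop
  have hfg : expMonomial a b = (fun w : ℂ => w ^ a) * fun w : ℂ => cexp (b * w) := rfl
  rw [hfg, iteratedDeriv_mul hf hg]
  simp only [iteratedDeriv_pow, iteratedDeriv_cexp_const_mul]
  unfold Q
  rw [sum_mul]
  refine sum_congr rfl fun μ _ => ?_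
  ring

/-- `d/dz (Q m a b z · e^{bz}) = Q (m+1) a b z · e^{bz}`. [folklore] -/
theorem hasDerivAt_Q_mul_exp (m a : ℕ) (b z : ℂ) :
    HasDerivAt (fun w => Q m a b w * cexp (b * w)) (Q (m + 1) a b z * cexp (b * z)) z := by
  have hfun : (fun w => Q m a b w * cexp (b * w)) = iteratedDeriv m (expMonomial a b) := by
    funext w; rw [iteratedDeriv_expMonomial]
  rw [hfun, ← iteratedDeriv_expMonomial, iteratedDeriv_succ]
  have hd : Differentiable ℂ (iteratedDeriv m (expMonomial a b)) :=
    ((differentiable_expMonomial a b).contDiff (n := ((m + 1 : ℕ) : ℕ∞))).differentiable_iteratedDeriv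
      m (by exact_mod_cast Nat.lt_succ_self m)
  exact (hd z).hasDerivAt

/-! ### The data of the normal form (1) -/

/-- **The data of a normalised counterexample** (Baker 1975, Ch. 2 §3, eq. (1), p. 19): logarithms
`l₀, …, lₙ` of algebraic numbers, linearly independent over `ℚ`, and algebraic
`β₀', β₀, …, β_{n-1}` with `β₀' + ∑ βᵣ lᵣ = lₙ`. `NormalForm` says that no such data exist; the
proof of Theorem 2.1 derives a contradiction from a `Setup`. (Baker's `n` logarithms are the
`n + 1` numbers `l i` here; his `β₀` is `β₀` and his `β₁, …, β_{n-1}` are `β 0, …, β (n-1)`.)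
[cite: Baker1975, Ch. 2 §3, eq. (1)] -/
structure Setup where
  /-- the number of logarithms is `n + 1` -/
  n : ℕ
  /-- the logarithms `lᵢ = log αᵢ` -/
  l : Fin (n + 1) → ℂ
  /-- the constant coefficient `β₀` -/
  β₀ : ℂ
  /-- the coefficients `βᵣ` -/
  β : Fin n → ℂ
  isAlgebraic_exp : ∀ i, IsAlgebraic ℚ (cexp (l i))
  linearIndependent : LinearIndependent ℚ l
  isAlgebraic_β₀ : IsAlgebraic ℚ β₀
  isAlgebraic_β : ∀ r, IsAlgebraic ℚ (β r)
  rel : β₀ + ∑ r, β r * l (Fin.castSucc r) = l (Fin.last n)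

/-- `NormalForm` is exactly the statement that there is no `Setup`. [cite: Baker1975, Ch. 2 §3] -/
theorem normalForm_of_setup_false (h : Setup → False) : NormalForm :=
  fun n l halg hli β₀ β hβ₀ hβ hrel => (h ⟨n, l, β₀, β, halg, hli, hβ₀, hβ, hrel⟩).elim

/-- The index set of the coefficients `p(λ₀, λ₁, …, λ_N)` (`0 ≤ λᵢ ≤ L`) of the auxiliary
function: `λ₀` (the power of `z₀`) and `λ' = (λ₁, …, λ_N)` (indexed by the logarithms).
[cite: Baker1975, Ch. 2 Lemma 2] -/
abbrev Idx (n L : ℕ) := Fin (L + 1) × (Fin (n + 1) → Fin (L + 1))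

/-- `#Idx = (L+1)^{n+2}` (Baker's `N = (L+1)^{n+1}` unknowns, p. 22).
[cite: Baker1975, Ch. 2 Lemma 2] -/
theorem card_Idx (n L : ℕ) : Fintype.card (Idx n L) = (L + 1) ^ (n + 2) := by
  simp [Idx, Fintype.card_prod, pow_succ]; ring

/-- The multi-index `m + eᵢ` (one more differentiation in the variable `zᵢ`). [folklore] -/
def bump {k : ℕ} (m : Fin k → ℕ) (i : Fin k) : Fin k → ℕ := fun j => m j + if j = i then 1 else 0

/-- Components of `m + eᵢ`. [folklore] -/
@[simp] theorem bump_apply {k : ℕ} (m : Fin k → ℕ) (i j : Fin k) :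
    bump m i j = m j + if j = i then 1 else 0 := rfl

/-- `|m + eᵢ| = |m| + 1`. [folklore] -/
theorem sum_bump {k : ℕ} (m : Fin k → ℕ) (i : Fin k) : ∑ j, bump m i j = ∑ j, m j + 1 := by
  simp [bump, sum_add_distrib]

namespace Setup

variable (S : Setup) {L : ℕ}

/-- The numbers `αᵢ = e^{lᵢ}`. [cite: Baker1975, Ch. 2 §3] -/
def α (i : Fin (S.n + 1)) : ℂ := cexp (S.l i)

/-- `ψ_λ = λ₁ log α₁ + ⋯ + λ_N log α_N` (Baker 1975, p. 26). [cite: Baker1975, Ch. 2 §5] -/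
def w (v : Fin (S.n + 1) → Fin (L + 1)) : ℂ := ∑ i, ((v i : ℕ) : ℂ) * S.l i

/-- `λ_N β₀`, the coefficient in the exponential `e^{λ_N β₀ z₀}` (p. 21).
[cite: Baker1975, Ch. 2 Lemma 2] -/
def bq (v : Fin (S.n + 1) → Fin (L + 1)) : ℂ := ((v (Fin.last S.n) : ℕ) : ℂ) * S.β₀

/-- `γᵣ = λᵣ + λ_N βᵣ` (p. 21). [cite: Baker1975, Ch. 2 Lemma 2] -/
def γ (v : Fin (S.n + 1) → Fin (L + 1)) (r : Fin S.n) : ℂ :=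
  ((v (Fin.castSucc r) : ℕ) : ℂ) + ((v (Fin.last S.n) : ℕ) : ℂ) * S.β r

/-- The factor `∏ᵣ (γᵣ log αᵣ)^{mᵣ}` produced by `mᵣ` differentiations in `zᵣ` (`r ≥ 1`).
[cite: Baker1975, Ch. 2 Lemma 2] -/
def A (v : Fin (S.n + 1) → Fin (L + 1)) (m : Fin (S.n + 1) → ℕ) : ℂ :=
  ∏ r : Fin S.n, (S.γ v r * S.l (Fin.castSucc r)) ^ m r.succ

/-- One term of `Φ_{m₀,…,m_{n-1}}(z, …, z)`: for the index `u = (λ₀, λ')`,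
`Q m₀ λ₀ (λ_N β₀) z · ∏ᵣ (γᵣ lᵣ)^{mᵣ} · e^{ψ_λ z}` — the closed form (5) of Baker 1975, p. 21, in
which the relation (1) has been used to write `e^{λ_N β₀ z} ∏ αᵣ^{γᵣ z} = e^{ψ_λ z}`.
[cite: Baker1975, Ch. 2 Lemma 2, eq. (5)] -/
def term (u : Idx S.n L) (m : Fin (S.n + 1) → ℕ) (z : ℂ) : ℂ :=
  Q (m 0) (u.1 : ℕ) (S.bq u.2) z * S.A u.2 m * cexp (S.w u.2 * z)

/-- **The auxiliary function**: `f(z) = Φ_{m₀,…,m_{n-1}}(z,…,z) = ∑_λ p(λ) · term`, as a function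
of the integer coefficients `p` and the multi-index `m` (Baker 1975, Lemma 2 and eq. (7)).
[cite: Baker1975, Ch. 2 Lemmas 2–3] -/
def F (p : Idx S.n L → ℤ) (m : Fin (S.n + 1) → ℕ) (z : ℂ) : ℂ :=
  ∑ u, (p u : ℂ) * S.term u m z

/-! ### The relation (1) and the derivative of `F` -/

/-- The relation (1) in the form used for differentiation: `ψ_λ - λ_N β₀ = ∑ᵣ γᵣ lᵣ`.
[cite: Baker1975, Ch. 2 §3, eq. (1)] -/
theorem w_sub_bq (v : Fin (S.n + 1) → Fin (L + 1)) :
    S.w v - S.bq v = ∑ r, S.γ v r * S.l (Fin.castSucc r) := by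
  have hrel := S.rel
  simp only [w, bq, γ, Fin.sum_univ_castSucc]
  rw [← hrel]
  simp only [add_mul, sum_add_distrib, mul_add, mul_sum]
  ring_nf

/-- `A (m + e₀) = A m`. [folklore] -/
theorem A_bump_zero (v : Fin (S.n + 1) → Fin (L + 1)) (m : Fin (S.n + 1) → ℕ) :
    S.A v (bump m 0) = S.A v m := by
  unfold A
  refine prod_congr rfl fun r _ => ?_
  rw [bump_apply, if_neg (Fin.succ_ne_zero r), add_zero]

/-- `A (m + e_{r+1}) = A m · γᵣ lᵣ`. [folklore] -/
theorem A_bump_succ (v : Fin (S.n + 1) → Fin (L + 1)) (m : Fin (S.n + 1) → ℕ)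
    (r : Fin S.n) :
    S.A v (bump m r.succ) = S.A v m * (S.γ v r * S.l (Fin.castSucc r)) := by
  unfold A
  have h : ∀ r' : Fin S.n, (S.γ v r' * S.l (Fin.castSucc r')) ^ bump m r.succ r'.succ =
      (S.γ v r' * S.l (Fin.castSucc r')) ^ m r'.succ *
        (if r' = r then S.γ v r * S.l (Fin.castSucc r) else 1) := by
    intro r'
    rw [bump_apply, pow_add]
    congr 1
    by_cases hr : r' = r
    · subst hr; simp
    · have : r'.succ ≠ r.succ := fun e => hr (Fin.succ_injective _ e)
      rw [if_neg this, if_neg hr, pow_zero]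
  simp_rw [h]
  rw [prod_mul_distrib, prod_ite_eq' univ r, if_pos (mem_univ r)]

/-- The derivative of one term: `d/dz term_m = term_{m+e₀} + ∑ᵣ term_{m+e_{r+1}}` (the chain
rule behind "`f_m(r)` is given by `(∂/∂z₀ + ⋯ + ∂/∂z_{n-1})^m Φ`", Baker 1975, p. 23).
[cite: Baker1975, Ch. 2 Lemma 4] -/
theorem hasDerivAt_term (u : Idx S.n L) (m : Fin (S.n + 1) → ℕ) (z : ℂ) :
    HasDerivAt (S.term u m)
      (S.term u (bump m 0) z + ∑ r : Fin S.n, S.term u (bump m r.succ) z) z := by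
  have hexp : ∀ x, cexp (S.w u.2 * x) =
      cexp (S.bq u.2 * x) * cexp ((S.w u.2 - S.bq u.2) * x) := by
    intro x; rw [← Complex.exp_add]; ring_nf
  have hsplit : S.term u m = fun x => (Q (m 0) (u.1 : ℕ) (S.bq u.2) x * cexp (S.bq u.2 * x)) *
      (S.A u.2 m * cexp ((S.w u.2 - S.bq u.2) * x)) := by
    funext x; simp only [term, hexp x]; ring
  rw [hsplit]
  have h1 := hasDerivAt_Q_mul_exp (m 0) (u.1 : ℕ) (S.bq u.2) z
  have h2 : HasDerivAt (fun x => S.A u.2 m * cexp ((S.w u.2 - S.bq u.2) * x))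
      (S.A u.2 m * (cexp ((S.w u.2 - S.bq u.2) * z) * (S.w u.2 - S.bq u.2))) z := by
    have : HasDerivAt (fun x => cexp ((S.w u.2 - S.bq u.2) * x))
        (cexp ((S.w u.2 - S.bq u.2) * z) * (S.w u.2 - S.bq u.2)) z := by
      have h := ((hasDerivAt_id z).const_mul (S.w u.2 - S.bq u.2)).cexp
      simpa using h
    exact this.const_mul _
  refine (h1.fun_mul h2).congr_deriv ?_
  -- identify the derivative
  have e0 : S.term u (bump m 0) z = Q (m 0 + 1) (u.1 : ℕ) (S.bq u.2) z * cexp (S.bq u.2 * z) *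
      (S.A u.2 m * cexp ((S.w u.2 - S.bq u.2) * z)) := by
    simp only [term, A_bump_zero, bump_apply, if_true, hexp z]; ring
  have er : ∀ r : Fin S.n, S.term u (bump m r.succ) z =
      Q (m 0) (u.1 : ℕ) (S.bq u.2) z * cexp (S.bq u.2 * z) *
        (S.A u.2 m * cexp ((S.w u.2 - S.bq u.2) * z)) * (S.γ u.2 r * S.l (Fin.castSucc r)) := by
    intro r
    simp only [term, A_bump_succ, bump_apply, if_neg (Fin.succ_ne_zero r).symm, add_zero, hexp z]
    ring
  rw [e0]
  simp_rw [er]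
  rw [← mul_sum, ← w_sub_bq]
  ring

/-- **The derivative of the auxiliary function**: `d/dz F_m = ∑ᵢ F_{m + eᵢ}`.
[cite: Baker1975, Ch. 2 Lemma 4] -/
theorem hasDerivAt_F (p : Idx S.n L → ℤ) (m : Fin (S.n + 1) → ℕ) (z : ℂ) :
    HasDerivAt (S.F p m) (∑ i, S.F p (bump m i) z) z := by
  have h : HasDerivAt (S.F p m) (∑ u, (p u : ℂ) *
      (S.term u (bump m 0) z + ∑ r : Fin S.n, S.term u (bump m r.succ) z)) z := by
    unfold F
    exact HasDerivAt.fun_sum fun u _ => (S.hasDerivAt_term u m z).const_mul _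
  refine h.congr_deriv ?_
  rw [Fin.sum_univ_succ]
  simp only [F, mul_add, sum_add_distrib, mul_sum]
  congr 1
  exact sum_comm

/-- `F_m` is entire. [folklore] -/
theorem differentiable_F (p : Idx S.n L → ℤ) (m : Fin (S.n + 1) → ℕ) :
    Differentiable ℂ (S.F p m) := fun z => (S.hasDerivAt_F p m z).differentiableAt

/-- `deriv F_m = ∑ᵢ F_{m+eᵢ}`. [cite: Baker1975, Ch. 2 Lemma 4] -/
theorem deriv_F (p : Idx S.n L → ℤ) (m : Fin (S.n + 1) → ℕ) :
    deriv (S.F p m) = fun z => ∑ i, S.F p (bump m i) z :=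
  funext fun z => (S.hasDerivAt_F p m z).deriv

/-- **Vanishing of derivatives from vanishing of values** (Baker 1975, p. 23: "`f_m(r) = 0` for
all `m ≤ S_{K+1}` since `m₀ + ⋯ + m_{n-1} + j₀ + ⋯ + j_{n-1} ≤ 2S_{K+1} ≤ S_K`"): if
`F_{m'}(r) = 0` whenever `|m'| ≤ T`, then `F_m^{(j)}(r) = 0` whenever `|m| + j ≤ T`.
[cite: Baker1975, Ch. 2 Lemma 4] -/
theorem iteratedDeriv_F_eq_zero (p : Idx S.n L → ℤ) (r : ℂ) (T : ℕ)
    (h : ∀ m : Fin (S.n + 1) → ℕ, ∑ i, m i ≤ T → S.F p m r = 0) :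
    ∀ (j : ℕ) (m : Fin (S.n + 1) → ℕ), (∑ i, m i) + j ≤ T → iteratedDeriv j (S.F p m) r = 0 := by
  intro j
  induction j with
  | zero => intro m hm; simpa using h m (by simpa using hm)
  | succ j ih =>
    intro m hm
    rw [iteratedDeriv_succ', S.deriv_F p m,
      iteratedDeriv_fun_sum fun i _ => ((S.differentiable_F p _).contDiff).contDiffAt]
    refine sum_eq_zero fun i _ => ih _ ?_
    rw [sum_bump]
    omega

/-! ### `φ = F₀` and its derivatives at `0` -/

/-- `F₀(z) = ∑_λ p(λ) z^{λ₀} e^{ψ_λ z}` (eq. (10), p. 26). [cite: Baker1975, Ch. 2 §5, eq. (10)] -/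
theorem F_zero_apply (p : Idx S.n L → ℤ) (z : ℂ) :
    S.F p 0 z = ∑ u, (p u : ℂ) * expMonomial (u.1 : ℕ) (S.w u.2) z := by
  simp [F, term, A, expMonomial]

/-- `φ_j(0) = ∑_λ p(λ) j(j-1)⋯(j-λ₀+1) ψ_λ^{j-λ₀}` (Baker 1975, p. 26).
[cite: Baker1975, Ch. 2 §5] -/
theorem iteratedDeriv_F_zero (p : Idx S.n L → ℤ) (j : ℕ) :
    iteratedDeriv j (S.F p 0) 0 =
      ∑ u, (p u : ℂ) * ((j.descFactorial (u.1 : ℕ) : ℂ) * S.w u.2 ^ (j - (u.1 : ℕ))) := by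
  have hF : S.F p 0 = fun z => ∑ u, (p u : ℂ) * expMonomial (u.1 : ℕ) (S.w u.2) z :=
    funext (S.F_zero_apply p)
  rw [hF, iteratedDeriv_fun_sum fun u _ => ?_]
  · refine sum_congr rfl fun u _ => ?_
    rw [iteratedDeriv_const_mul _ ((differentiable_expMonomial _ _).contDiff.contDiffAt),
      iteratedDeriv_expMonomial, Q_at_zero]
    simp
  · exact (((differentiable_expMonomial _ _).const_mul _).contDiff).contDiffAt


/-! ### Size bounds (Baker 1975, Lemma 3, first assertion) -/

/-- The logarithms are non-zero (they are linearly independent over `ℚ`). [folklore] -/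
theorem l_ne_zero (i : Fin (S.n + 1)) : S.l i ≠ 0 :=
  S.linearIndependent.ne_zero i

/-- `Λ = 1 + ∑ᵢ |log αᵢ|`, a common bound for the logarithms (one of Baker's constants `c`).
[cite: Baker1975, Ch. 2 §3] -/
def Λ : ℝ := 1 + ∑ i, ‖S.l i‖

/-- `B_β = 1 + |β₀| + ∑ᵣ |βᵣ|`, a common bound for the coefficients (one of Baker's constants
`c`). [cite: Baker1975, Ch. 2 §3] -/
def Bβ : ℝ := 1 + ‖S.β₀‖ + ∑ r, ‖S.β r‖

/-- `1 ≤ Λ`. [folklore] -/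
theorem one_le_Λ : 1 ≤ S.Λ := by
  have : 0 ≤ ∑ i, ‖S.l i‖ := by positivity
  unfold Λ; linarith

/-- `|log αᵢ| ≤ Λ`. [folklore] -/
theorem norm_l_le (i : Fin (S.n + 1)) : ‖S.l i‖ ≤ S.Λ := by
  have h : ‖S.l i‖ ≤ ∑ j, ‖S.l j‖ :=
    single_le_sum (f := fun j => ‖S.l j‖) (fun j _ => norm_nonneg _) (mem_univ i)
  unfold Λ; linarith

/-- `1 ≤ B_β`. [folklore] -/
theorem one_le_Bβ : 1 ≤ S.Bβ := by
  have : 0 ≤ ∑ r, ‖S.β r‖ := by positivity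
  have := norm_nonneg S.β₀
  unfold Bβ; linarith

/-- `|β₀| ≤ B_β`. [folklore] -/
theorem norm_β₀_le : ‖S.β₀‖ ≤ S.Bβ := by
  have : 0 ≤ ∑ r, ‖S.β r‖ := by positivity
  unfold Bβ; linarith

/-- `|βᵣ| ≤ B_β`. [folklore] -/
theorem norm_β_le (r : Fin S.n) : ‖S.β r‖ ≤ S.Bβ := by
  have h : ‖S.β r‖ ≤ ∑ j, ‖S.β j‖ :=
    single_le_sum (f := fun j => ‖S.β j‖) (fun j _ => norm_nonneg _) (mem_univ r)
  have := norm_nonneg S.β₀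
  unfold Bβ; linarith

/-- `|ψ_λ| ≤ L Λ` (Baker 1975, p. 26: `σ ≤ c₁₄ L`). [cite: Baker1975, Ch. 2 §5] -/
theorem norm_w_le (v : Fin (S.n + 1) → Fin (L + 1)) : ‖S.w v‖ ≤ L * S.Λ := by
  unfold w
  calc ‖∑ i, ((v i : ℕ) : ℂ) * S.l i‖ ≤ ∑ i, ‖((v i : ℕ) : ℂ) * S.l i‖ := norm_sum_le _ _
    _ ≤ ∑ i, (L : ℝ) * ‖S.l i‖ := by
        refine sum_le_sum fun i _ => ?_
        rw [norm_mul, Complex.norm_natCast]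
        exact mul_le_mul_of_nonneg_right (by exact_mod_cast Nat.lt_succ_iff.mp (v i).isLt)
          (norm_nonneg _)
    _ = L * ∑ i, ‖S.l i‖ := by rw [mul_sum]
    _ ≤ L * S.Λ := by
        refine mul_le_mul_of_nonneg_left ?_ (Nat.cast_nonneg _)
        unfold Λ; linarith

/-- `|λ_N β₀| ≤ L B_β`. [cite: Baker1975, Ch. 2 Lemma 3] -/
theorem norm_bq_le (v : Fin (S.n + 1) → Fin (L + 1)) : ‖S.bq v‖ ≤ L * S.Bβ := by
  unfold bq
  rw [norm_mul, Complex.norm_natCast]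
  exact mul_le_mul (by exact_mod_cast Nat.lt_succ_iff.mp (v _).isLt) S.norm_β₀_le
    (norm_nonneg _) (Nat.cast_nonneg _)

/-- `|γᵣ| ≤ L B_β` (Baker 1975, p. 22: `|γᵣ| ≤ c L`). [cite: Baker1975, Ch. 2 Lemma 3] -/
theorem norm_γ_le (v : Fin (S.n + 1) → Fin (L + 1)) (r : Fin S.n) : ‖S.γ v r‖ ≤ L * S.Bβ := by
  unfold γ
  have h1 : ((v (Fin.castSucc r) : ℕ) : ℝ) ≤ L := by
    exact_mod_cast Nat.lt_succ_iff.mp (v _).isLt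
  have h2 : ((v (Fin.last S.n) : ℕ) : ℝ) ≤ L := by
    exact_mod_cast Nat.lt_succ_iff.mp (v _).isLt
  have h3 := S.norm_β_le r
  have h4 : ‖S.β₀‖ + ∑ j, ‖S.β j‖ ≤ S.Bβ - 1 := by unfold Bβ; linarith
  calc ‖((v (Fin.castSucc r) : ℕ) : ℂ) + ((v (Fin.last S.n) : ℕ) : ℂ) * S.β r‖
      ≤ ‖((v (Fin.castSucc r) : ℕ) : ℂ)‖ + ‖((v (Fin.last S.n) : ℕ) : ℂ) * S.β r‖ := norm_add_le _ _
    _ = ((v (Fin.castSucc r) : ℕ) : ℝ) + ((v (Fin.last S.n) : ℕ) : ℝ) * ‖S.β r‖ := by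
        rw [norm_mul, Complex.norm_natCast, Complex.norm_natCast]
    _ ≤ L + L * ‖S.β r‖ := by gcongr
    _ = L * (1 + ‖S.β r‖) := by ring
    _ ≤ L * S.Bβ := by
        refine mul_le_mul_of_nonneg_left ?_ (Nat.cast_nonneg _)
        have : ‖S.β r‖ ≤ ∑ j, ‖S.β j‖ :=
          single_le_sum (f := fun j => ‖S.β j‖) (fun j _ => norm_nonneg _) (mem_univ r)
        have := norm_nonneg S.β₀
        linarith

/-- `|∏ᵣ (γᵣ log αᵣ)^{mᵣ}| ≤ (L B_β Λ)^{∑ mᵣ}` (Baker 1975, p. 22: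
`|P γ₁^{m₁} ⋯ γ_{n-1}^{m_{n-1}}| ≤ (c₉ L)^{m₁+⋯+m_{n-1}}`). [cite: Baker1975, Ch. 2 Lemma 3] -/
theorem norm_A_le (v : Fin (S.n + 1) → Fin (L + 1)) (m : Fin (S.n + 1) → ℕ) :
    ‖S.A v m‖ ≤ (L * S.Bβ * S.Λ) ^ (∑ r : Fin S.n, m r.succ) := by
  unfold A
  rw [norm_prod, ← prod_pow_eq_pow_sum]
  refine prod_le_prod (fun r _ => norm_nonneg _) fun r _ => ?_
  rw [norm_pow]
  refine pow_le_pow_left₀ (norm_nonneg _) ?_ _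
  rw [norm_mul]
  have h0 : (0 : ℝ) ≤ L * S.Bβ := mul_nonneg (Nat.cast_nonneg _) (by linarith [S.one_le_Bβ])
  exact mul_le_mul (S.norm_γ_le v r) (S.norm_l_le _) (norm_nonneg _) h0

/-- **Size of one term** (Baker 1975, p. 22): `|term| ≤ (2 L B_β Λ)^{|m|} max(1,|z|)^L e^{L Λ |z|}`.
[cite: Baker1975, Ch. 2 Lemma 3] -/
theorem norm_term_le (u : Idx S.n L) (m : Fin (S.n + 1) → ℕ) (z : ℂ) :
    ‖S.term u m z‖ ≤
      (2 * L * S.Bβ * S.Λ) ^ (∑ i, m i) * max 1 ‖z‖ ^ L * Real.exp (L * S.Λ * ‖z‖) := by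
  have hΛ := S.one_le_Λ
  have hB := S.one_le_Bβ
  have hL0 : (0 : ℝ) ≤ L := Nat.cast_nonneg _
  have hz1 : (1 : ℝ) ≤ max 1 ‖z‖ := le_max_left _ _
  have hbase : (0 : ℝ) ≤ 2 * L * S.Bβ * S.Λ := by positivity
  -- the polynomial factor
  have hQ : ‖Q (m 0) (u.1 : ℕ) (S.bq u.2) z‖ ≤ (2 * L * S.Bβ * S.Λ) ^ m 0 * max 1 ‖z‖ ^ L := by
    refine (norm_Q_le _ _ _ _).trans ?_
    have h1 : ((u.1 : ℕ) : ℝ) + ‖S.bq u.2‖ ≤ 2 * L * S.Bβ * S.Λ := by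
      have e1 : ((u.1 : ℕ) : ℝ) ≤ L := by exact_mod_cast Nat.lt_succ_iff.mp u.1.isLt
      have e2 := S.norm_bq_le u.2
      have e3 : (L : ℝ) ≤ L * S.Bβ := le_mul_of_one_le_right hL0 hB
      have e4 : (L : ℝ) * S.Bβ ≤ L * S.Bβ * S.Λ := le_mul_of_one_le_right (by positivity) hΛ
      linarith
    have h2 : max 1 ‖z‖ ^ (u.1 : ℕ) ≤ max 1 ‖z‖ ^ L :=
      pow_le_pow_right₀ hz1 (Nat.lt_succ_iff.mp u.1.isLt)
    exact mul_le_mul (pow_le_pow_left₀ (by positivity) h1 _) h2 (by positivity) (by positivity)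
  -- the constant factor
  have hA : ‖S.A u.2 m‖ ≤ (2 * L * S.Bβ * S.Λ) ^ (∑ r : Fin S.n, m r.succ) := by
    refine (S.norm_A_le u.2 m).trans (pow_le_pow_left₀ (by positivity) ?_ _)
    have : (0 : ℝ) ≤ L * S.Bβ * S.Λ := by positivity
    linarith
  -- the exponential factor
  have hE : ‖cexp (S.w u.2 * z)‖ ≤ Real.exp (L * S.Λ * ‖z‖) := by
    rw [Complex.norm_exp]
    refine Real.exp_le_exp.mpr ((Complex.re_le_norm _).trans ?_)
    rw [norm_mul]
    exact mul_le_mul_of_nonneg_right (S.norm_w_le u.2) (norm_nonneg _)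
  have hsum : (∑ i, m i) = m 0 + ∑ r : Fin S.n, m r.succ := Fin.sum_univ_succ m
  calc ‖S.term u m z‖ = ‖Q (m 0) (u.1 : ℕ) (S.bq u.2) z‖ * ‖S.A u.2 m‖ * ‖cexp (S.w u.2 * z)‖ := by
        rw [term, norm_mul, norm_mul]
    _ ≤ (2 * L * S.Bβ * S.Λ) ^ m 0 * max 1 ‖z‖ ^ L * (2 * L * S.Bβ * S.Λ) ^ (∑ r : Fin S.n, m r.succ)
          * Real.exp (L * S.Λ * ‖z‖) := by gcongr
    _ = (2 * L * S.Bβ * S.Λ) ^ (∑ i, m i) * max 1 ‖z‖ ^ L * Real.exp (L * S.Λ * ‖z‖) := by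
        rw [hsum, pow_add]; ring

/-- **Baker 1975, Lemma 3, first assertion** (p. 22): if `|p(λ)| ≤ B` for all `λ` then
`|f_m(z)| ≤ (L+1)^{n+2} B (2 L B_β Λ)^{|m|} max(1,|z|)^L e^{L Λ |z|}` (the source writes the
right-hand side as `c₅^{h² + L|z|}` for its choice of parameters). [cite: Baker1975, Ch. 2 Lemma 3] -/
theorem norm_F_le (p : Idx S.n L → ℤ) {B : ℝ} (hB : ∀ u, |(p u : ℝ)| ≤ B)
    (m : Fin (S.n + 1) → ℕ) (z : ℂ) :
    ‖S.F p m z‖ ≤ ((L + 1 : ℕ) : ℝ) ^ (S.n + 2) * B *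
      ((2 * L * S.Bβ * S.Λ) ^ (∑ i, m i) * max 1 ‖z‖ ^ L * Real.exp (L * S.Λ * ‖z‖)) := by
  have hB0 : 0 ≤ B := (abs_nonneg _).trans (hB default)
  unfold F
  calc ‖∑ u, (p u : ℂ) * S.term u m z‖ ≤ ∑ u, ‖(p u : ℂ) * S.term u m z‖ := norm_sum_le _ _
    _ ≤ ∑ _u : Idx S.n L, B *
          ((2 * L * S.Bβ * S.Λ) ^ (∑ i, m i) * max 1 ‖z‖ ^ L * Real.exp (L * S.Λ * ‖z‖)) := by
        refine sum_le_sum fun u _ => ?_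
        rw [norm_mul, Complex.norm_intCast]
        exact mul_le_mul (hB u) (S.norm_term_le u m z) (norm_nonneg _) hB0
    _ = ((L + 1 : ℕ) : ℝ) ^ (S.n + 2) * B *
          ((2 * L * S.Bβ * S.Λ) ^ (∑ i, m i) * max 1 ‖z‖ ^ L * Real.exp (L * S.Λ * ‖z‖)) := by
        rw [sum_const, card_univ, card_Idx, nsmul_eq_mul]
        push_cast
        ring

end Setup

end Literature.NumberTheory.Transcendental.Baker1975
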